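import Literature.MathematicalPhysics.QuantumFieldTheory.Balaban1983to89.Node00.TorusCoverCubeMemberRecordDentZd
import Literature.MathematicalPhysics.QuantumFieldTheory.Balaban1983to89.Node00.DomainsMeet
import Literature.MathematicalPhysics.QuantumFieldTheory.Balaban1983to89.B8BlockConstantLiftStabilityRec

/-!
# NODE 00 — THE CELLS OF THE MEET `D″ = cubeDomains ⊓ D₂` ARE (1.29)-CELLS OF THE DENTED RECORD DATUM `recordCubePZ … (D₂.Om j)`: the top and the DENT LAYER
# ([15] (148)–(150); the dictionary row the junction's knit needs to read `Restr129Z` at the cells where the chart reads row 9′)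

Cell `pub-ymgap`, width seat `pub-ymgap-dag-n07-w3` g13 (junction side of the K0 road; ⚑ LOCATED-TOP-DENT, cell bus 2026-08-29 I.30757, Q1 = YES I.30862).  `--kind proof --supports
stmt-QuantumFields-20541` (K0⁷; count-neutral; THEOREMS ONLY).  [15] = [Balaban1985Variational]; [6] = [Balaban1985RegularSpaces]; [II] = [Balaban1984PropagatorsII]; [I] = [Balaban1987RG1].

WHY.  Row 9′ of the premise of record is indexed by the cells `Λ′_{j′}(D″)` of the meet (torus, [II] (2.3)); the crown's (1.29) normalisation `Restr129Z L j c.lamS 1 u₀` is indexed by the cells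
`c.lamS j′` of the `ℤᵈ` datum (centred labels, anchored at `c_{j−j′}·𝟙` under the cover).  For the knit to read `R̄^{j′}u₀ = 1` where the chart reads row 9′, every `D″`-cell must be (the
anchored cover of) a crown cell.  With the EMPTY-dent datum this FAILS on the dent layer (the cells under `π″□_j ∖ Ω_j`); with the DENTED datum `recordCubePZ … (Dtop := D₂.Om j)` of the
preceding file it holds — THIS FILE proves it: unconditionally for the two layers the dent touches (the top `j′ = j` and the dent layer `j′ + 1 = j`), and for the layers below ∕ level `0`
inside `□₀ᶻ` under the displayed per-cell row «below the top the record does not dent» ([15] (148) «`Ω′_{j′} = □_{j′}`», at the record = the knit's collar (b) «`π(□̃) ⊆ Ω_{j−1}`» +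
nesting); level `0` off `□₀` is the junction's gluing, ✓p748195 §4∕§5.

WHAT IS PROVED (kernel; `Params`, odd `L`; no estimate).
§1 `blockMap_pow_succ_smul'` (`⌊L^{j′}·s ∕ L^{j′+1}⌋ = ⌊s∕L⌋`), ★ `blockOf_coverAt_mem_cubeDomains_Om_succ` (an INNER label of level `j′ < j` has its parent block in `Ω′_{j′+1}` of the cube family),
   `flmZ_eq_of_underZ_pred` (for `x` under the level-`(j−1)` label `z`: `flmZ L j x = flmZ L 1 z`), `iterBlockOf_cover_anchor_eq_blockOf` (its cover reading: the level-`j` block of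
   `π(x + c_j·𝟙)` is `blockOf (π_{j−1}(z + c_1·𝟙))`).
§2 ★★★ `exists_lamS_top_of_lamSite_meet` (`j′ = j`: a top cell of `D″` is the cover of a top cell of `recordCubePZ … (D₂.Om j)`), ★★★ `exists_lamS_dent_of_lamSite_meet` (`j′ + 1 = j`,
   `1 ≤ j′`: a dent-layer cell of `D″` — in particular every end of a DENT PAIR — is the anchored cover of a level-`j′` cell of the dented datum; the crown's top condition «tower ⊆ Ω′_j» is
   read through `liftTopZ` as «parent block ∈ D₂.Om j», so «inner ∧ tower ⊆ Ω′_j» would make the cell deep in `D″`), ★★ `exists_lamS_below_of_lamSite_meet` (`1 ≤ j′`,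
   `j′ + 1 < j`, under the displayed per-cell no-dent row «`blockOf y ∈ Ω′_{j′+1}(□) → blockOf y ∈ D₂.Om (j′+1)`»), ★★ `mem_lamS_zero_of_lamSite_meet` (level `0` inside `□₀ᶻ`; `j = 1`
   unconditionally, `j ≥ 2` under the no-dent row at level `1`).
HONEST FRAMING: count-neutral; set bookkeeping between two typings; nothing of [6]∕[15]∕[I] asserted; the no-dent row below the top and level `0` off `□₀` are NOT discharged here; `HThm4RecSym152Phi(E)` ∕ `HThm4Rec*`
UNDISCHARGED; N05 ∕ N07 NOT discharged; K0⁷ ∕ K1⁹ NOT closed; counts unmoved; one finite 𝕋⁴ programme at fixed ε — R4 closes the conditional finite-𝕋⁴ rung `BalabanLadder.UV` only; the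
YM mass gap (Clay) is NOT proved by any of this; nothing continuum ∕ ℝ⁴ ∕ OS.  No `def`, no `sorry`, no `instance`, no `notation`.

References: [15] (144) p. 300, (148)–(150) p. 301; [6] (1.29) p. 81, (1.131) p. 99, (1.3)–(1.4) p. 77; [II] (2.1)–(2.3) p. 224; [I] (0.1) p. 251, (0.3) p. 252.
-/

noncomputable section

namespace Literature.MathematicalPhysics.QuantumFieldTheory.Balaban1983to89.Node00

open scoped Matrix.Norms.L2Operator
open Literature.MathematicalPhysics.QuantumLattice (blockMap)
open B7Prop1Local (InBox)
open BlockAveragingZd (ctrShift)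
open B8Eq131Cubes (tLo tHi sqLo sqHi inLo inHi cube)
open B8Eq131CubesRec (cubeZ tcubeZ sqLoZ sqHiZ inLoZ inHiZ)
open B8Eq131CubesRecDictionary (inBox_sqZ_iff_add_ctrShift inBox_inZ_iff_add_ctrShift)
open B8Eq131CubesAdmissible (smul_mem_cube_succ_iff)
open B8Eq131CubesAdmissibleRec (cubeFamZ)
open B8Eq119TwistedAxialRec (UnderZ flmZ underZ_flmZ underZ_iff_flmZ_eq)
open B8BlockConstantLiftStabilityRec (underZ_add)
open B15Eq112TorusCover (cover)
open B14DomainGeom (Pt)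
open B5Eq118OneStroke (iterBlockOf)
open B6SectADomainsV1 (Domains)

variable {P : Params}

/-! ## §1  Labels: inner labels have their parent in the next cube; the anchored tower of a dent-layer label reads the parent block -/

section Labels

/-- `⌊L^{j′}·s ∕ L^{j′+1}⌋ = ⌊s ∕ L⌋` coordinatewise. [cite: Balaban1987RG1, (0.1) p.251 (bookkeeping)] -/
theorem blockMap_pow_succ_smul' (j' : ℕ) (s : Pt P.d) : blockMap (P.L ^ (j' + 1)) (((P.L : ℤ) ^ j') • s) = blockMap P.L s := by
  funext i
  simp only [blockMap, Pi.smul_apply, smul_eq_mul]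
  push_cast
  rw [pow_succ, Int.mul_ediv_mul_of_pos _ _ (pow_pos (by exact_mod_cast P.L_pos) j')]

/-- ★ **AN INNER LABEL HAS ITS PARENT BLOCK IN THE NEXT CUBE'S REGION**: for `1 ≤ j′ < j ≤ m + K` and a level-`j′` label `s` of the inner box `□_{j′+1}^{(j′)}` (`[inLo, inHi]`), the
parent block of `π_{j′} s` lies in `Ω′_{j′+1} = π_{j′+1}″□_{j′+1}^{(j′+1)}` of print's cube family. [cite: Balaban1985RegularSpaces, (1.131) p.99, (1.4) p.77; Balaban1984PropagatorsII, (2.3) p.224; Balaban1987RG1, (0.1) p.251] -/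
theorem blockOf_coverAt_mem_cubeDomains_Om_succ {a : Pt P.d} {M ρ j : ℕ} {hk : j ≤ P.m + P.K} {j' : ℕ} (hj'j : j' < j) {s : Pt P.d}
    (hs : InBox (inLo P.L a ρ j j') (inHi P.L a M ρ j j') s) :
    blockOf (coverAt P j' s) ∈ (cubeDomains P a M ρ j hk).Om (j' + 1) := by
  have hmem : ((P.L : ℤ) ^ j') • s ∈ cube P.L a M ρ j (j' + 1) := (smul_mem_cube_succ_iff P.L_pos a M ρ hj'j s).2 hs
  have hb := blockMap_inBox_of_mem_cube hmem
  rw [blockMap_pow_succ_smul'] at hb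
  rw [blockOf_coverAt (by omega : j' + 1 ≤ P.m + P.K)]
  exact coverAt_mem_cubeDomains_Om (by omega) (by omega) hb

/-- For a fine site `x` under the level-`(j′)` centred label `z` (depth `j′`), the level-`(j′+1)` centred label of `x` is the parent `flmZ L 1 z` of `z` (odd `L`).
[cite: Balaban1985RegularSpaces, p.79 («x_n ∈ B(x_{n+1})»); Balaban1987RG1, (0.3) p.252] -/
theorem flmZ_succ_eq_of_underZ {j' : ℕ} {z x : Pt P.d} (hx : UnderZ P.L j' z x) : flmZ P.L (j' + 1) x = flmZ P.L 1 z := by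
  have h1 : UnderZ P.L 1 (flmZ P.L 1 z) z := underZ_flmZ P.hL.1 1 z
  have h := underZ_add P.hL.1 h1 hx
  rw [Nat.add_comm] at h
  exact ((underZ_iff_flmZ_eq P.hL.1 (j' + 1) _ x).1 h)

/-- ★ **THE ANCHORED TOWER READS THE PARENT BLOCK**: for `j′ + 1 = j ≤ m + K`, a level-`j′` centred label `z` and a fine site `x` under it, the level-`j` torus block of the anchored site
`π(x + c_j·𝟙)` is the block `blockOf (π_{j′}(z + c_1·𝟙))` of the anchored cover of `z`. [cite: Balaban1987RG1, (0.1) p.251, (0.3) p.252; Balaban1985RegularSpaces, (1.4) p.77] -/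
theorem iterBlockOf_cover_anchor_eq_blockOf {j' : ℕ} (hjK : j' + 1 ≤ P.m + P.K) {z x : Pt P.d} (hx : UnderZ P.L j' z x) :
    iterBlockOf (j' + 1) (cover P (x + fun _ => ((ctrShift P.L (j' + 1) : ℕ) : ℤ))) = blockOf (coverAt P j' (z + fun _ => ((ctrShift P.L (j' + 1 - j') : ℕ) : ℤ))) := by
  rw [iterBlockOf_cover hjK, blockMap_pow_add_ctrShift, flmZ_succ_eq_of_underZ hx, blockOf_coverAt hjK,
    show j' + 1 - j' = 1 by omega]
  congr 1
  have h := blockMap_pow_add_ctrShift (P := P) 1 z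
  rw [pow_one] at h
  exact h.symm

end Labels

/-! ## §2  The top and the dent layer: meet cells are anchored covers of crown cells of the dented datum -/

section Cells

variable {Mc ρ j : ℕ} (hj : 1 ≤ j) (hjK : j ≤ P.m + P.K) (hρ : P.L ≤ ρ) (idx : Pt P.d) (D₂ : Domains P)

/-- ★★★ **TOP CELLS**: a top cell `y ∈ Λ′_j(D″) = Ω′_j(□) ∩ D₂.Om j` is the cover `π_j z` of a top (1.29)-cell `z ∈ (recordCubePZ … (D₂.Om j)).lamS j` of the dented datum (no anchor shift at
the top): `z` is `y`'s label in `□_j^{(j)}`, and its whole centred `j`-tower lies in `□̃ᶻ` (`□_jᶻ ⊆ □̃ᶻ`) and in the lift of `D₂.Om j` (its level-`j` block IS `y`).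
[cite: Balaban1985Variational, (150) p.301 («Ω′_k = □_k ∩ Ω_k»); Balaban1985RegularSpaces, (1.29) p.81, (1.131) p.99; Balaban1984PropagatorsII, (2.3) p.224; Balaban1987RG1, (0.3) p.252] -/
theorem exists_lamS_top_of_lamSite_meet {y : Site P j}
    (hy : (domainsMeet (cubeDomains P (cornerP P Mc ρ idx) (sideP P Mc ρ) ρ j hjK) D₂).LamSite j y) :
    ∃ z : Pt P.d, z ∈ (recordCubePZ P j hj hjK Mc ρ hρ idx (D₂.Om j)).lamS j ∧ coverAt P j (z + fun _ => ((ctrShift P.L (j - j) : ℕ) : ℤ)) = y := by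
  obtain ⟨hOm, -⟩ := hy
  obtain ⟨hsq, hD⟩ := (mem_domainsMeet_Om _ _ _ _).1 hOm
  obtain ⟨s, hs, rfl⟩ := (mem_cubeDomains_Om_iff hj le_rfl _).1 hsq
  have h0 : (s + fun _ => ((ctrShift P.L (j - j) : ℕ) : ℤ)) = s := by
    funext i; simp [BlockAveragingZd.ctrShift]
  refine ⟨s, ?_, by rw [h0]⟩
  have hρ1 : 1 ≤ ρ := le_trans (le_trans (by norm_num) P.hL.2) hρ
  -- unfold the crown's top cell predicate
  simp only [CubeB8DZ.lamS, recordCubePZ_k, le_refl, if_true, Set.mem_setOf_eq, lt_irrefl, IsEmpty.forall_iff, and_true, forall_true_left]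
  refine ⟨?_, fun x hx => ?_⟩
  · -- the label box: centred top box = corner top box
    rw [show (recordCubePZ P j hj hjK Mc ρ hρ idx (D₂.Om j)).a = cornerP P Mc ρ idx from rfl,
      show (recordCubePZ P j hj hjK Mc ρ hρ idx (D₂.Om j)).ρ = ρ from rfl,
      show (recordCubePZ P j hj hjK Mc ρ hρ idx (D₂.Om j)).M = sideP P Mc ρ from rfl,
      B8Eq131CubesRecDictionary.inBox_sqZ_top_iff]
    exact hs
  · -- the tower under `s` lies in `Ω′_j = □̃ᶻ ∩ liftTopZ`
    rw [dentFamZ_top]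
    refine ⟨?_, ?_⟩
    · exact B8Eq131CubesRec.cube_subset_tcube P.hL.1 P.hL.2 hρ1 le_rfl
        ((B8Eq131CubesRec.mem_cube_iff P.hL.1).2 ⟨s, (B8Eq131CubesRecDictionary.inBox_sqZ_top_iff _ _ _ _ _ _).2 hs, hx⟩)
    · rw [mem_liftTopZ_iff, iterBlockOf_cover hjK, blockMap_pow_add_ctrShift, (underZ_iff_flmZ_eq P.hL.1 j s x).1 hx]
      exact hD

/-- ★★★ **DENT-LAYER CELLS** (`j′ + 1 = j`, `1 ≤ j′`): a cell `y ∈ Λ′_{j′}(D″)` — in particular each end of a DENT PAIR, whose parent block lies in `π″□_j ∖ D₂.Om j` — is the anchored cover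
`π_{j′}(z + c_1·𝟙)` of a level-`j′` (1.29)-cell `z` of the DENTED datum `recordCubePZ … (D₂.Om j)`: `z` lies in the centred label box of `□_{j′}`, and the crown's exclusion «inner ∧ (tower ⊆
Ω′_j)» fails because it would put `y`'s parent block in `Ω′_j(□) ∩ D₂.Om j = Om_j(D″)`, i.e. make `y` deep.  (With the EMPTY dent the exclusion is «inner» alone and these cells are lost.)
[cite: Balaban1985Variational, (148)–(150) p.301; Balaban1985RegularSpaces, (1.29) p.81, (1.131) p.99; Balaban1984PropagatorsII, (2.3) p.224; Balaban1987RG1, (0.1) p.251, (0.3) p.252] -/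
theorem exists_lamS_dent_of_lamSite_meet {j' : ℕ} (hj'1 : 1 ≤ j') (hj' : j' + 1 = j) {y : Site P j'}
    (hy : (domainsMeet (cubeDomains P (cornerP P Mc ρ idx) (sideP P Mc ρ) ρ j hjK) D₂).LamSite j' y) :
    ∃ z : Pt P.d, z ∈ (recordCubePZ P j hj hjK Mc ρ hρ idx (D₂.Om j)).lamS j' ∧ coverAt P j' (z + fun _ => ((ctrShift P.L (j - j') : ℕ) : ℤ)) = y := by
  subst hj'
  have hj'j : j' < j' + 1 := Nat.lt_succ_self _
  have hj'le : j' ≤ j' + 1 := hj'j.le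
  obtain ⟨hOm, hnd⟩ := hy
  obtain ⟨hsq, -⟩ := (mem_domainsMeet_Om _ _ _ _).1 hOm
  obtain ⟨s, hs, hsy⟩ := (mem_cubeDomains_Om_iff hj'1 hj'le _).1 hsq
  -- the centred label `z := s − c_{j−j′}·𝟙`
  refine ⟨s - fun _ => ((ctrShift P.L (j' + 1 - j') : ℕ) : ℤ), ?_, by rw [sub_add_cancel]; exact hsy⟩
  have hz : (s - fun _ => ((ctrShift P.L (j' + 1 - j') : ℕ) : ℤ)) + (fun _ => ((ctrShift P.L (j' + 1 - j') : ℕ) : ℤ)) = s := sub_add_cancel _ _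
  simp only [CubeB8DZ.lamS, recordCubePZ_k, hj'le, if_true, Set.mem_setOf_eq]
  refine ⟨?_, fun h => absurd h (by omega), fun _ => ?_⟩
  · -- the label box, centred ↔ corner
    rw [show (recordCubePZ P (j' + 1) hj hjK Mc ρ hρ idx (D₂.Om (j' + 1))).a = cornerP P Mc ρ idx from rfl,
      show (recordCubePZ P (j' + 1) hj hjK Mc ρ hρ idx (D₂.Om (j' + 1))).ρ = ρ from rfl,
      show (recordCubePZ P (j' + 1) hj hjK Mc ρ hρ idx (D₂.Om (j' + 1))).M = sideP P Mc ρ from rfl,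
      inBox_sqZ_iff_add_ctrShift, hz]
    exact hs
  · -- «inner ∧ tower ⊆ Ω′_j» would make `y` deep in `D″`
    rintro ⟨hin, htop⟩
    apply hnd
    -- `y`'s parent block is in `Ω′_j(□)` …
    have hin' : InBox (inLo P.L (cornerP P Mc ρ idx) ρ (j' + 1) j') (inHi P.L (cornerP P Mc ρ idx) (sideP P Mc ρ) ρ (j' + 1) j') s := by
      rw [show (recordCubePZ P (j' + 1) hj hjK Mc ρ hρ idx (D₂.Om (j' + 1))).a = cornerP P Mc ρ idx from rfl,
        show (recordCubePZ P (j' + 1) hj hjK Mc ρ hρ idx (D₂.Om (j' + 1))).ρ = ρ from rfl,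
        show (recordCubePZ P (j' + 1) hj hjK Mc ρ hρ idx (D₂.Om (j' + 1))).M = sideP P Mc ρ from rfl,
        inBox_inZ_iff_add_ctrShift, hz] at hin
      exact hin
    have h1 : blockOf y ∈ (cubeDomains P (cornerP P Mc ρ idx) (sideP P Mc ρ) ρ (j' + 1) hjK).Om (j' + 1) := by
      rw [← hsy]; exact blockOf_coverAt_mem_cubeDomains_Om_succ hj'j hin'
    -- … and in `D₂.Om j`, by the top condition read through the lift at the fine centre under `z`
    have h2 : blockOf y ∈ D₂.Om (j' + 1) := by
      have hx : UnderZ P.L j' (s - fun _ => ((ctrShift P.L (j' + 1 - j') : ℕ) : ℤ)) (((P.L : ℤ) ^ j') • (s - fun _ => ((ctrShift P.L (j' + 1 - j') : ℕ) : ℤ))) :=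
        B8BlockConstantLiftStabilityRec.underZ_pow_smul P.L j' _
      have hmem := (htop trivial _ hx)
      rw [dentFamZ_top] at hmem
      have hl := hmem.2
      rw [mem_liftTopZ_iff, iterBlockOf_cover_anchor_eq_blockOf hjK hx, hz, hsy] at hl
      exact hl
    show blockOf y ∈ (domainsMeet _ D₂).Om (j' + 1)
    exact (mem_domainsMeet_Om _ _ _ _).2 ⟨h1, h2⟩

/-- ★★ **THE LAYERS BELOW THE DENT** (`1 ≤ j′`, `j′ + 1 < j`): a cell `y ∈ Λ′_{j′}(D″)` is the anchored cover `π_{j′}(z + c_{j−j′}·𝟙)` of a level-`j′` (1.29)-cell of the dented datum,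
PROVIDED the record does not dent at level `j′ + 1` at this cell: «`blockOf y ∈ Ω′_{j′+1}(□) → blockOf y ∈ D₂.Om (j′+1)`» ([15] (148) «`Ω′_{j′} = □_{j′}`, `j′ < k`»; at the record this is
the knit's collar (b) «`π(□̃) ⊆ Ω_{j−1}`» + nesting, displayed here per cell).  Below the dent the crown's exclusion is «inner» alone, and «inner» puts the parent block in `Ω′_{j′+1}(□)`.
[cite: Balaban1985Variational, (144) p.300, (148) p.301; Balaban1985RegularSpaces, (1.29) p.81, (1.131) p.99; Balaban1984PropagatorsII, (2.3) p.224; Balaban1987RG1, (0.3) p.252] -/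
theorem exists_lamS_below_of_lamSite_meet {j' : ℕ} (hj'1 : 1 ≤ j') (hj'j : j' + 1 < j) {y : Site P j'}
    (hy : (domainsMeet (cubeDomains P (cornerP P Mc ρ idx) (sideP P Mc ρ) ρ j hjK) D₂).LamSite j' y)
    (hD : blockOf y ∈ (cubeDomains P (cornerP P Mc ρ idx) (sideP P Mc ρ) ρ j hjK).Om (j' + 1) → blockOf y ∈ D₂.Om (j' + 1)) :
    ∃ z : Pt P.d, z ∈ (recordCubePZ P j hj hjK Mc ρ hρ idx (D₂.Om j)).lamS j' ∧ coverAt P j' (z + fun _ => ((ctrShift P.L (j - j') : ℕ) : ℤ)) = y := by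
  have hj'le : j' ≤ j := by omega
  have hlt : j' < j := by omega
  obtain ⟨hOm, hnd⟩ := hy
  obtain ⟨hsq, -⟩ := (mem_domainsMeet_Om _ _ _ _).1 hOm
  obtain ⟨s, hs, hsy⟩ := (mem_cubeDomains_Om_iff hj'1 hj'le _).1 hsq
  refine ⟨s - fun _ => ((ctrShift P.L (j - j') : ℕ) : ℤ), ?_, by rw [sub_add_cancel]; exact hsy⟩
  have hz : (s - fun _ => ((ctrShift P.L (j - j') : ℕ) : ℤ)) + (fun _ => ((ctrShift P.L (j - j') : ℕ) : ℤ)) = s := sub_add_cancel _ _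
  simp only [CubeB8DZ.lamS, recordCubePZ_k, hj'le, if_true, Set.mem_setOf_eq]
  refine ⟨?_, fun h => absurd h (by omega), fun _ => ?_⟩
  · rw [show (recordCubePZ P j hj hjK Mc ρ hρ idx (D₂.Om j)).a = cornerP P Mc ρ idx from rfl,
      show (recordCubePZ P j hj hjK Mc ρ hρ idx (D₂.Om j)).ρ = ρ from rfl,
      show (recordCubePZ P j hj hjK Mc ρ hρ idx (D₂.Om j)).M = sideP P Mc ρ from rfl,
      inBox_sqZ_iff_add_ctrShift, hz]
    exact hs
  · rintro ⟨hin, -⟩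
    apply hnd
    have hin' : InBox (inLo P.L (cornerP P Mc ρ idx) ρ j j') (inHi P.L (cornerP P Mc ρ idx) (sideP P Mc ρ) ρ j j') s := by
      rw [show (recordCubePZ P j hj hjK Mc ρ hρ idx (D₂.Om j)).a = cornerP P Mc ρ idx from rfl,
        show (recordCubePZ P j hj hjK Mc ρ hρ idx (D₂.Om j)).ρ = ρ from rfl,
        show (recordCubePZ P j hj hjK Mc ρ hρ idx (D₂.Om j)).M = sideP P Mc ρ from rfl,
        inBox_inZ_iff_add_ctrShift, hz] at hin
      exact hin
    have h1 : blockOf y ∈ (cubeDomains P (cornerP P Mc ρ idx) (sideP P Mc ρ) ρ j hjK).Om (j' + 1) := by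
      rw [← hsy]; exact blockOf_coverAt_mem_cubeDomains_Om_succ hlt hin'
    show blockOf y ∈ (domainsMeet _ D₂).Om (j' + 1)
    exact (mem_domainsMeet_Om _ _ _ _).2 ⟨h1, hD h1⟩

/-- ★★ **LEVEL `0` INSIDE PRINT's `□₀`**: a fine site `x ∈ □₀ᶻ` (centred) whose anchored cover `π(x + c_j·𝟙)` is a level-`0` cell of `D″` is a level-`0` (1.29)-cell of the dented datum —
for `j ≥ 2` under the no-dent row at level `1` (as above), for `j = 1` (the dent layer IS level `0`) unconditionally.  (Level-`0` cells of `D″` OFF `□₀` are the junction's gluing, ✓p748195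
§4∕§5 — `Domains.Om_zero := T`.) [cite: Balaban1985Variational, (148)–(150) p.301; Balaban1985RegularSpaces, (1.29) p.81 («R̄⁰u = u on Λ₀»), (1.131) p.99; Balaban1984PropagatorsII, (2.3) p.224; Balaban1987RG1, (0.3) p.252] -/
theorem mem_lamS_zero_of_lamSite_meet {x : Pt P.d} (hx : x ∈ cubeZ P.L (cornerP P Mc ρ idx) (sideP P Mc ρ) ρ j 0)
    (hy : (domainsMeet (cubeDomains P (cornerP P Mc ρ idx) (sideP P Mc ρ) ρ j hjK) D₂).LamSite 0 (cover P (x + fun _ => ((ctrShift P.L j : ℕ) : ℤ))))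
    (hD : 2 ≤ j → blockOf (cover P (x + fun _ => ((ctrShift P.L j : ℕ) : ℤ))) ∈ (cubeDomains P (cornerP P Mc ρ idx) (sideP P Mc ρ) ρ j hjK).Om 1 →
      blockOf (cover P (x + fun _ => ((ctrShift P.L j : ℕ) : ℤ))) ∈ D₂.Om 1) :
    x ∈ (recordCubePZ P j hj hjK Mc ρ hρ idx (D₂.Om j)).lamS 0 := by
  obtain ⟨-, hnd⟩ := hy
  -- the label box at level 0: `x ∈ □₀ᶻ` is `InBox (sqLoZ 0) (sqHiZ 0) x`
  obtain ⟨z, hz, hzx⟩ := (B8Eq131CubesRec.mem_cube_iff P.hL.1).1 hx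
  have hzx' : x = z := (B8Eq119TwistedAxialRec.underZ_zero_iff P.L z x).1 hzx
  subst hzx'
  simp only [CubeB8DZ.lamS, recordCubePZ_k, Nat.zero_le, if_true, Set.mem_setOf_eq]
  refine ⟨hz, fun h => absurd h (by omega), fun _ => ?_⟩
  rintro ⟨hin, htop⟩
  apply hnd
  have hin' : InBox (inLo P.L (cornerP P Mc ρ idx) ρ j 0) (inHi P.L (cornerP P Mc ρ idx) (sideP P Mc ρ) ρ j 0) (x + fun _ => ((ctrShift P.L j : ℕ) : ℤ)) := by
    rw [show (recordCubePZ P j hj hjK Mc ρ hρ idx (D₂.Om j)).a = cornerP P Mc ρ idx from rfl,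
      show (recordCubePZ P j hj hjK Mc ρ hρ idx (D₂.Om j)).ρ = ρ from rfl,
      show (recordCubePZ P j hj hjK Mc ρ hρ idx (D₂.Om j)).M = sideP P Mc ρ from rfl,
      inBox_inZ_iff_add_ctrShift, Nat.sub_zero] at hin
    exact hin
  have h1 : blockOf (cover P (x + fun _ => ((ctrShift P.L j : ℕ) : ℤ))) ∈ (cubeDomains P (cornerP P Mc ρ idx) (sideP P Mc ρ) ρ j hjK).Om (0 + 1) := by
    rw [← coverAt_zero]; exact blockOf_coverAt_mem_cubeDomains_Om_succ hj hin'
  show blockOf _ ∈ (domainsMeet _ D₂).Om (0 + 1)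
  refine (mem_domainsMeet_Om _ _ _ _).2 ⟨h1, ?_⟩
  rcases Nat.lt_or_ge j 2 with hj1 | hj2
  · -- `j = 1`: the dent layer is level `0`; read the top condition through the lift at `x` itself
    have hj1' : j = 1 := by omega
    subst hj1'
    have hxx : UnderZ P.L 0 x x := (B8Eq119TwistedAxialRec.underZ_zero_iff P.L x x).2 rfl
    have hmem := htop (by norm_num) x hxx
    rw [dentFamZ_top] at hmem
    have hl := hmem.2
    rw [mem_liftTopZ_iff, iterBlockOf_cover_anchor_eq_blockOf (j' := 0) hjK hxx] at hl
    have h0 : (x + fun _ => ((ctrShift P.L (0 + 1 - 0) : ℕ) : ℤ)) = x + fun _ => ((ctrShift P.L 1 : ℕ) : ℤ) := by norm_num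
    rw [h0] at hl
    rw [← coverAt_zero]
    exact hl
  · exact hD hj2 h1

end Cells

end Literature.MathematicalPhysics.QuantumFieldTheory.Balaban1983to89.Node00

end
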